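import Mathlib.LinearAlgebra.Matrix.NonsingularInverse
import Mathlib.Data.Real.Basic
import HarnessLib

/-!
# Tangent/normal block decomposition for the structured Newton–penalty iteration (Luenberger–Ye, held copy §14.6)

[LY08] = D. G. Luenberger, Y. Ye, *Linear and Nonlinear Programming* [LuenbergerYe2008], chapter
"Lagrange methods" (numbered 14 in the held copy `book:luenberger2008-linear-nonlinear-programming`,
15 in the Springer 2008 printing), section "Rate of convergence" (§14.6). The rate of the iteration
`x_{k+1} = x_k − (B + cAᵀA)⁻¹∇P(x_k)ᵀ` is governed by the eigenvalues of
`(B + cAᵀA)⁻¹(L + cAᵀA)` (56); to analyse them the book changes basis with `[C, D]`, where the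
columns of `C` (`n × (n − m)`) form an orthonormal basis of the tangent subspace `M = {x : Ax = 0}`
and `D = Aᵀ(AAᵀ)⁻¹`: "Then `AC = 0`, `AD = I`, `CᵀC = I`, `CᵀD = 0`", and
```
[C, D]ᵀ(B + cAᵀA)[C, D] = [[CᵀBC, CᵀBD], [DᵀBC, DᵀBD + cI]]
```
(likewise with `L`), whose `c → ∞` limit has the eigenvalues of `B_M⁻¹L_M` (`B_M = CᵀBC`,
`L_M = CᵀLC`) together with those of `I` (Theorem: rate no greater than `[(A − a)/(A + a)]²`).

We record the finite-dimensional identities blockwise (no block-matrix type is needed):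
* `constraintNormalBasis A = Aᵀ(AAᵀ)⁻¹` (`D`); `AD = I` for `AAᵀ` nonsingular (`mul_constraintNormalBasis`);
  `CᵀD = 0` from `AC = 0` (`tangent_transpose_mul_constraintNormalBasis`).
* the four blocks of `[C, D]ᵀ(B + cAᵀA)[C, D]`: `Cᵀ(B + cAᵀA)C = CᵀBC`, `Cᵀ(B + cAᵀA)D = CᵀBD`,
  `Dᵀ(B + cAᵀA)C = DᵀBC`, `Dᵀ(B + cAᵀA)D = DᵀBD + cI` (`tangent_block`, `tangent_normal_block`,
  `normal_tangent_block`, `normal_block`; the held copy prints the last block as `DᵀBC + cI`, a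
  misprint for `DᵀBD + cI`).

Published results only (Lean placement rule): every public declaration carries its
`[cite: LuenbergerYe2008, §14.6 …]` locator (held-copy numbering).
-/

namespace Literature.Analysis.Convex.PenaltyNewtonTangentBlocks

open Matrix

variable {m n k : Type*} [Fintype m] [Fintype n] [DecidableEq m]

/-- `D = Aᵀ(AAᵀ)⁻¹`, the basis of the normal space `M^⊥` paired with `A`.
[cite: LuenbergerYe2008, §14.6 "Let D = Aᵀ(AAᵀ)⁻¹"] -/
noncomputable def constraintNormalBasis (A : Matrix m n ℝ) : Matrix n m ℝ :=
  Aᵀ * (A * Aᵀ)⁻¹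

/-- `AD = I` (for `AAᵀ` nonsingular, i.e. `A` of full row rank). [cite: LuenbergerYe2008, §14.6 "AD = I"] -/
theorem mul_constraintNormalBasis {A : Matrix m n ℝ} (hA : IsUnit (A * Aᵀ).det) : A * constraintNormalBasis A = 1 := by
  rw [constraintNormalBasis, ← Matrix.mul_assoc, mul_nonsing_inv _ hA]

/-- `CᵀD = 0` whenever `AC = 0` (the columns of `C` lie in the tangent subspace).
[cite: LuenbergerYe2008, §14.6 "CᵀD = 0"] -/
theorem tangent_transpose_mul_constraintNormalBasis (A : Matrix m n ℝ) {C : Matrix n k ℝ} (hAC : A * C = 0) :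
    Cᵀ * constraintNormalBasis A = 0 := by
  rw [constraintNormalBasis, ← Matrix.mul_assoc, ← transpose_mul, hAC, transpose_zero, Matrix.zero_mul]

omit [DecidableEq m] in
/-- Tangent–tangent block: `Cᵀ(B + cAᵀA)C = CᵀBC` when `AC = 0`.
[cite: LuenbergerYe2008, §14.6 block display after (56)] -/
theorem tangent_block (B : Matrix n n ℝ) (A : Matrix m n ℝ) {C : Matrix n k ℝ} (hAC : A * C = 0)
    (c : ℝ) : Cᵀ * (B + c • (Aᵀ * A)) * C = Cᵀ * B * C := by
  rw [Matrix.mul_add, Matrix.add_mul, Matrix.mul_smul, Matrix.smul_mul,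
    Matrix.mul_assoc Cᵀ (Aᵀ * A) C, Matrix.mul_assoc Aᵀ A C, hAC, Matrix.mul_zero, Matrix.mul_zero,
    smul_zero, add_zero]

/-- Tangent–normal block: `Cᵀ(B + cAᵀA)D = CᵀBD` when `AC = 0`.
[cite: LuenbergerYe2008, §14.6 block display after (56)] -/
theorem tangent_normal_block (B : Matrix n n ℝ) (A : Matrix m n ℝ) {C : Matrix n k ℝ}
    (hAC : A * C = 0) (c : ℝ) :
    Cᵀ * (B + c • (Aᵀ * A)) * constraintNormalBasis A = Cᵀ * B * constraintNormalBasis A := by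
  have hCA : Cᵀ * Aᵀ = 0 := by rw [← transpose_mul, hAC, transpose_zero]
  rw [Matrix.mul_add, Matrix.add_mul, Matrix.mul_smul, Matrix.smul_mul, ← Matrix.mul_assoc Cᵀ Aᵀ A,
    hCA, Matrix.zero_mul, Matrix.zero_mul, smul_zero, add_zero]

/-- Normal–tangent block: `Dᵀ(B + cAᵀA)C = DᵀBC` when `AC = 0`.
[cite: LuenbergerYe2008, §14.6 block display after (56)] -/
theorem normal_tangent_block (B : Matrix n n ℝ) (A : Matrix m n ℝ) {C : Matrix n k ℝ}
    (hAC : A * C = 0) (c : ℝ) :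
    (constraintNormalBasis A)ᵀ * (B + c • (Aᵀ * A)) * C = (constraintNormalBasis A)ᵀ * B * C := by
  rw [Matrix.mul_add, Matrix.add_mul, Matrix.mul_smul, Matrix.smul_mul,
    Matrix.mul_assoc (constraintNormalBasis A)ᵀ (Aᵀ * A) C, Matrix.mul_assoc Aᵀ A C, hAC, Matrix.mul_zero,
    Matrix.mul_zero, smul_zero, add_zero]

/-- Normal–normal block: `Dᵀ(B + cAᵀA)D = DᵀBD + cI` (for `AAᵀ` nonsingular; the held copy's
`DᵀBC + cI` is a misprint). [cite: LuenbergerYe2008, §14.6 block display after (56)] -/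
theorem normal_block (B : Matrix n n ℝ) {A : Matrix m n ℝ} (hA : IsUnit (A * Aᵀ).det) (c : ℝ) :
    (constraintNormalBasis A)ᵀ * (B + c • (Aᵀ * A)) * constraintNormalBasis A =
      (constraintNormalBasis A)ᵀ * B * constraintNormalBasis A + c • 1 := by
  have hAD : A * constraintNormalBasis A = 1 := mul_constraintNormalBasis hA
  have hDA : (constraintNormalBasis A)ᵀ * Aᵀ = 1 := by rw [← transpose_mul, hAD, transpose_one]
  rw [Matrix.mul_add, Matrix.add_mul, Matrix.mul_smul, Matrix.smul_mul,
    ← Matrix.mul_assoc (constraintNormalBasis A)ᵀ Aᵀ A, hDA, Matrix.one_mul, hAD]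

end Literature.Analysis.Convex.PenaltyNewtonTangentBlocks
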